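import Summits.ResolutionOfSingularities.ResolutionOfSingularities.Theses.SectionAscent
import Summits.ResolutionOfSingularities.ResolutionOfSingularities.Theorems.AffineToGlobal.Negative.OneShotHypothesis
import Summits.ResolutionOfSingularities.ResolutionOfSingularities.Theorems.AffineToGlobal.Negative.CentreNotUnique
import Summits.ResolutionOfSingularities.ResolutionOfSingularities.Theorems.AffineToGlobal.Negative.WeakFrameStubs
import Summits.ResolutionOfSingularities.ResolutionOfSingularities.Theorems.AffineToGlobal.Negative.ReducedSingularLocusCentre
import Literature.AlgebraicGeometry.Resolution.AffineBlowupRegular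
import Literature.AlgebraicGeometry.Resolution.Temkin2008Localization
import HarnessLib

/-!
# Disproof of `AffineToGlobal` (stmt-ResolutionOfSingularities-15961) — findings

Crux (route `SectionAscent`, rank 4): `AffineToGlobal` =
`∀ p, p.Prime → (∀ d, OneShot p d) → ResolutionInChar.{0} p`, where `OneShot p d` is the
route's affine one-shot statement S⁺ (every integral affine `Spec A` of finite type over a field
of characteristic `p`, `dim A < d`, has an ideal `I ≠ ⊥` with `Bl_I(Spec A)` regular and
`V(I) = Sing(Spec A)` exactly).

**Verdict of cycle 1 (cdisprove): NO KILL — the crux is unfalsifiable short of refuting the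
summit.** Kernel-checked below:

**Verdict of cycle 2 (cdisprove gen 2, 2026-08-17, after the lead's reshape 3 and the death of
line `birth`): still NO KILL, and none is possible for the two open residues either** — both
`stub_infiniteSingularLocus` (Temkin cut) and `stub_isolatingBlowup` (weak-frame cut) carry the
crux's hypothesis `∀ d, OneShot p d` (= strong affine one-shot resolution in characteristic `p`,
open from dimension 3 on), so an unconditional `¬stub` would need that hypothesis as a theorem.
What gen 2 adds, all LANDED under `Theorems/AffineToGlobal/Negative/` and re-exported below:
* (c') `CentreNotUnique.lean` (p162244): **the hypothesis never determines its centre** — if `I`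
  is a one-shot centre of a singular integral Noetherian affine scheme then so is `I·I ≠ I`
  (`Bl_{I·I} ≅ Bl_I`, Stacks 080A + uniqueness of blow-ups); the cusp `K[X², X³]` (singular at
  the origin, dimension 1, finite type) has two distinct one-shot centres over EVERY field of
  EVERY prime characteristic (existence from the landed curve case `OneShot p 2`,
  `OneShotCurves.stub_oneShotCurves`); hence the natural strengthening `∃! I` of `OneShot p 2`
  is FALSE for every prime `p` (`not_oneShot_two_existsUnique`). This is the kernel-level form
  of the route's named risk "chartwise one-shot ideals are not canonical and need not glue": a
  gluing proof of `AffineToGlobal` must bring its own choice principle (canonical / equivariant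
  centres), the hypothesis supplies none — exactly the mechanism three lead generations found
  missing (`KERNEL.md` §"What would close it" 1–2, `KERNEL-2.md` §5, `Lines/birth-dead.md`).
* (d2) `WeakFrameStubs.lean` (p162423): guards of the weak-frame residue `stub_isolatingBlowup`
  — without `J₁ ≠ ⊥` its conclusion is vacuous on every scheme (blow-up along `⊥` is empty);
  without `IsIntegral X` it is false (the empty closed subscheme of `ℙⁿ_K` has no ideal sheaf
  `≠ ⊥`); where `(Reg X)ᶜ` is finite it holds by the identity (`J₁ = ⊤`). So the stub's content
  is exactly "positive-dimensional singular loci of projective varieties", the locus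
  `KERNEL-2.md` §3 shows unreachable from affine one-shots; no junk instance breaks it.
  For `stub_infiniteSingularLocus`: `hinf` alone forces `I ≠ ⊥` and `S'` singular
  (`centre_ne_bot_of_infinite`, `not_isRegular_of_infinite` below), so neither the empty blow-up
  nor `Scheme.IsRegular.admitsDesingularization` is available; the `ih` is genuine currency
  only below the local dimension of `x` (lead's analysis, not re-derived); joint sufficiency of
  both cuts is the lead's kernel-checked `AffineToGlobal_of_infiniteSingularLocus` /
  `AffineToGlobal_of_isolatingBlowup`. Could not break either stub; both are honest and
  strong-resolution-typed (their conclusions are `Sing`-supported / nonzero-centre BLOW-UPS with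
  regular or isolated-singular source, not the weak `HasResolution`).
* (e) `BlowupChartEmbedding.lean` / `PointBlowupNotRegular.lean` / `ReducedSingularLocusCentre.lean`
  (negative lemmas IV-a/b/c, p163762 / p164202 / p164577): **the one CANONICAL candidate centre
  — the reduced singular locus (vanishing ideal of the non-regular points), which does glue to a
  global ideal sheaf — is NOT a one-shot centre**, already for curves, where `OneShot p 2` HOLDS
  (landed): for `A = K[X², X⁵]` (`y² = x⁵`) over any field, `Sing A` is exactly the origin
  `𝔪 = (X², X⁵)` (`singularLocus_cusp25`: non-regular at `𝔪` by integral-closedness, regular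
  elsewhere as local rings of `A[1/X²] = K[X][1/X]`), and `Bl_𝔪(Spec A)` is NOT regular — its
  `X²`-chart ring embeds in `K[X]` as a `K[X², X³]`-like subring via the universal property of the
  Rees algebra (`exists_chart_ringHom`), singular at its origin, and charts are open
  (`Proj.awayι`). Refuted strengthenings, every prime `p`: `not_reducedPoint_oneShotCentre`
  (blowing up a singular closed point of an affine curve need not be regular) and
  `not_reducedSingularLocus_oneShotCentre` (blowing up `⨅ {𝔮 | A_𝔮 not regular} 𝔮` need not be
  regular). Together with (c') this closes the canonicity question from both sides: the
  hypothesis offers no distinguished centre, and the only distinguished centre on offer is not a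
  hypothesis-witness. (The `δ`-drop theorem of the tree is an inequality and could not be used;
  the chart computation was done directly.)

Attacks run in cycle 2 (in-Lean on the farm; no `kit compute` job — nothing finite to scan):
re-elaboration (`W.lean` rc 0, body by `Iff.rfl`); junk hunt in the reshape-3 predicates
(`IsBlowup` along `⊥`/`⊤`, `IsDesingularization` with `J = ⊥` — excluded by `support ⊆ Singᶜ`
at the generic point —, `IdealSheafData` on `∅`, `projectiveSpace n K` with `X = ∅`, `n = 0`);
mutation of each hypothesis of `stub_isolatingBlowup` (`hι`: dropping finite type admits
non-Noetherian integral `X` — every blow-up non-regular almost everywhere — but a witness needs a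
`K`-point of Mathlib's `ℙⁿ`, not built; `hX`: refuted above; `J₁ ≠ ⊥`: vacuity above) and of
`stub_infiniteSingularLocus` (`hx`, `hs`, `hinf`, `ih`: each consistent, none droppable into a
refutation without `AffineOneShot p`); literature: Cossart–Piltant 2019 p. 3 (Sing-supported
blow-up form open in dim 3, read by gen 0's refuter) is the printed reason both residues are open.

* (a) LOAD-BEARING ANALYSIS.
  - `withoutOneShot_iff_summit`: dropping the hypothesis `∀ d, OneShot p d` leaves LITERALLY the
    summit `ResolutionOfSingularities`; `not_affineToGlobal_iff`: `¬ AffineToGlobal` is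
    equivalent to "some prime `p` has affine one-shots in all dimensions AND `¬ ResolutionInChar p`".
    Hence NO `_false_without_<H>` lemma can exist for this crux unless the summit itself fails at
    some prime: every weakening of a hypothesis is implied by the summit
    (`affineToGlobal_of_summit`). This is why the crux resists disproof: both sides are open
    (one-shot strong resolution of affine varieties from dim 4 on; resolution in char `p`).
  - `p.Prime` is NOT load-bearing: `resolutionInChar_of_not_prime` / `oneShot_of_not_prime`
    (no field has a composite non-zero characteristic, both sides vacuous) and
    `withoutPrime_iff`: the un-primed statement is `AffineToGlobal ∧ (char-0 instance)`, the
    char-0 instance being Hironaka-true (not in tree). Mutation finding: "hypothesis `p.Prime`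
    possibly unnecessary" — it only parks the char-0 case.
* (b) TIGHTNESS / REDUNDANCY inside the hypothesis predicate `OneShot`.
  - `centre_ne_bot_of_centre_iff`: the conjunct `I ≠ ⊥` is DECORATION — it follows from the
    `V(I) = Sing` clause (the zero ideal is prime in a domain and `A_{(0)}` is a field, hence a
    regular local ring).
  - `centre_eq_top_of_isRegularRing`: on a regular `A` the `V(I) = Sing` clause forces `I = ⊤`;
    `isRegular_affineBlowup_top`: `Bl_⊤(Spec A) = Proj A[t]` IS regular for regular `A` (via the
    tree's `affineBlowup.isRegular_of_isQuasiRegular` at the sequence `(1)`), so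
    `oneShot_witness_of_isRegularRing`: the hypothesis is satisfiable — by the unit ideal and only
    by it — on every regular integral affine variety; `oneShot_zero` (d = 0 vacuous: a domain has
    `ringKrullDim ≥ 0`) and `oneShot_one` (d = 1: a finite-type domain of dimension `< 1` over a
    field is a field) show the hypothesis family `∀ d, OneShot p d` is NOT junk-false at its base,
    so `AffineToGlobal` is not vacuously provable from a formalisation accident. (d = 2 is curve
    normalisation written as one `Sing`-supported blow-up — classical; d ≤ 4 is
    Cossart–Piltant 2019 Thm 1.1 (ii) + Hartshorne II Ex. 7.11 (c); open from d = 5.)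
* (c) NATURAL STRENGTHENINGS: none is small-model decidable. "Reduced centre" (take `I = √I`,
  the ideal of `Sing`) is false already for `y² = x⁵` (one point blow-up leaves `y² = x³`), but a
  Lean proof needs chart computations in `Proj R[It]` — not attempted (no bearing on the crux,
  which lets `I` be arbitrary). "Global one-shot" (an ideal SHEAF with `V = Sing` and regular
  blow-up on every integral separated finite-type `X`) is open even in dim 3
  (Cossart–Piltant 2019, p. 3) — not refutable.
* (d) `-- Line birth` (lead `prover-line-stmt-ResolutionOfSingularities-15961-0`, skeleton
  `Cruxes/AffineToGlobal/Lines/birth.lean`, reshape 1; no stuck stubs handed over). Joint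
  sufficiency is kernel-checked by the lead (`AffineToGlobal_of'`). Stub-by-stub:
  - `stub_idealExtension` (ideals of `𝒪_{X,x}` are extended from `Γ(X, U)`): TRUE for every
    scheme `X` (localisation: `I = (I ∩ R)·R_𝔭`, and the contraction of a non-zero ideal of a
    localisation is non-zero). No junk instance: `I ≠ ⊥` excludes the only degenerate case.
  - `stub_localModel` (one-shots pass to flat pre-immersions): TRUE in the stated generality,
    INCLUDING the non-Noetherian corner I probed: a flat surjective local homomorphism of local
    rings is an isomorphism with no finiteness hypothesis (if `R/I` is `R`-flat and `I ⊆ 𝔪` then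
    for `x ∈ I`, `x ∈ xI`, so `x(1-y) = 0` with `1-y` a unit), and the tree already has
    `isIso_stalkMap_of_flat_of_isPreimmersion` (BlowupsFlatBaseChange.lean) without Noetherian
    hypotheses; `J₀ = ⊥` gives the empty blow-up, covered by
    `Scheme.admitsDesingularization_of_isEmpty`. Could not break it.
  - `stub_affineToModification` (`AffineOneShot p → ModificationOneShot p`): OPEN, and of the
    same kind as the crux — its conclusion is strong one-shot resolution for projective
    birational models `W → Spec A`, its hypothesis the affine case; `ModificationOneShot` is
    honest (`ModificationOneShot.affine_case`, lead) and not junk-refutable (regular `W`: `J = ⊤`;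
    `W ≠ ∅` since `J₀ ≠ ⊥`). Not killable without settling one-shot resolution.
    WHY IT RESISTS PROOF (for the lead): every passage affine ⇒ `W` found goes through
    non-canonical chartwise centres (`I` and `I²` are both one-shot centres — no uniqueness to
    glue with) or through a smooth affine cover without section (cone `Spec A[J₀t] ∖ V₊ → W`,
    Jouanolou torsor), where S⁺ hands a NON-equivariant centre that does not descend; spreading
    out from `K(t)` dies on `Literature.Barriers.ResolutionOfSingularities.InseparableBaseChange`
    (regular generic fibre, every closed fibre `(y - x - a^{1/p})^p` non-reduced). Historically
    the globalisation of local resolutions was obtained only through FUNCTORIALITY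
    (Aroca–Hironaka–Vicente 1977 analytic; Bierstone–Milman 1997; Włodarczyk 2005; Kollár 2007
    Ch. 3) or through patching of local UNIFORMISATIONS in dim ≤ 3 (Piltant 2013,
    Cossart–Piltant 2019) — never from bare existence of local strong resolutions. I rate the
    stub (and the crux) open-problem-sized, not "L" as the route header has it.
    TRUE SUB-CASE (provable now, possibly worth a `--supports` lemma for the lead): if `Sing W`
    is contained in ONE affine open `V ⊆ W` (e.g. `Sing W` finite, `W` quasi-projective), the
    one-shot centre `I_V` of `V` (`V(I_V) = Sing W`, closed in `W`) glues with the unit ideal on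
    `W ∖ Sing W` to an ideal sheaf `J` with `Bl_J W` regular (`= Bl_{I_V} V` over `V`, `≅ W` over
    `W ∖ Sing W`). The obstruction is exactly a positive-dimensional (projective) singular locus
    inside a fibre of `W → Spec A`.

Attacks run this cycle (all in-Lean, `lean check` on the farm; no `kit compute` job — the
statement has no finite or low-degree instances beyond `d ≤ 1`): elaboration and symbol-by-symbol
reading of `AffineToGlobal`, `OneShot`, `affineBlowup := Proj (reesGrading I)`,
`Scheme.IsRegular`, `ResolutionInChar`, `IsBlowup` (GW Def. 13.90), `IsDesingularization`
(Temkin Def. 2.2.6); degenerate instances `d = 0, 1`, regular `A`, `I = ⊥/⊤`, composite `p`,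
`p = 0`; junk hunt in the line's predicates (`J₀ = ⊥`, empty `W`, non-Noetherian flat
pre-immersions); barrier catalogue `Literature/Barriers/ResolutionOfSingularities/*` (none bears
on a gluing statement; `QuasiExcellenceNecessary` is about non-excellent bases, ours are of finite
type over fields); `ledger negatives` (1 entry, DefectlessFrames, unrelated).
-/

noncomputable section

-- single-problem summit: the doubled namespace component `ResolutionOfSingularities` is forced
set_option linter.dupNamespace false

open CategoryTheory AlgebraicGeometry Literature.AlgebraicGeometry.Resolution
open Summit.ResolutionOfSingularities.ResolutionOfSingularities.Theses.SectionAscent (AffineToGlobal)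

namespace Summit.ResolutionOfSingularities.ResolutionOfSingularities.Cruxes.AffineToGlobal.Disproof

/-! ## The hypothesis predicate, by name -/

/-- `OneShot p d` — VERBATIM the `let`-bound predicate of `SectionAscent.AffineToGlobal`
(= `SectionAscent.OneShotAffine` at `(p, d)`): affine one-shot strong resolution in
characteristic `p` below dimension `d`. [cite: CossartPiltant2019, Thm. 1.1 and p. 3] -/
def OneShot (p d : ℕ) : Prop :=
  ∀ (K : Type) [Field K] [CharP K p] (A : Type) [CommRing A] [IsDomain A] [Algebra K A]
    [Algebra.FiniteType K A], ringKrullDim A < (d : WithBot ℕ∞) → ∃ I : Ideal A, I ≠ ⊥ ∧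
      Literature.AlgebraicGeometry.Resolution.Scheme.IsRegular
        (Literature.AlgebraicGeometry.Resolution.affineBlowup I) ∧
      ∀ 𝔭 : PrimeSpectrum A, I ≤ 𝔭.asIdeal ↔ ¬ IsRegularLocalRing (Localization.AtPrime 𝔭.asIdeal)

/-- The crux, unfolded (definitional: the `let` ζ-reduces to `OneShot`). [folklore] -/
theorem affineToGlobal_iff :
    AffineToGlobal ↔ ∀ p : ℕ, p.Prime → (∀ d : ℕ, OneShot p d) → ResolutionInChar.{0} p :=
  Iff.rfl

/-! ## (a) Load-bearing analysis -/

/-- The crux with its hypothesis `∀ d, OneShot p d` DROPPED. [folklore] -/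
def AffineToGlobalWithoutOneShot : Prop :=
  ∀ p : ℕ, p.Prime → ResolutionInChar.{0} p

/-- Dropping the one-shot hypothesis leaves literally the summit statement: no
`_false_without_OneShot` lemma exists unless the summit is false. [folklore] -/
theorem withoutOneShot_iff_summit :
    AffineToGlobalWithoutOneShot ↔ _root_.ResolutionOfSingularities :=
  Iff.rfl

/-- The summit implies the crux (ignore the hypothesis). [folklore] -/
theorem affineToGlobal_of_summit (h : _root_.ResolutionOfSingularities) : AffineToGlobal :=
  fun p hp _ => h p hp

/-- **What a refutation of the crux would have to be**: a prime `p` at which affine one-shot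
resolution holds in every dimension while resolution of singularities fails — in particular a
refutation of the summit at `p`. [folklore] -/
theorem not_affineToGlobal_iff :
    ¬ AffineToGlobal ↔ ∃ p : ℕ, p.Prime ∧ (∀ d : ℕ, OneShot p d) ∧ ¬ ResolutionInChar.{0} p := by
  rw [affineToGlobal_iff]
  push Not
  rfl

/-- A refutation of the crux refutes the summit. [folklore] -/
theorem not_summit_of_not_affineToGlobal (h : ¬ AffineToGlobal) :
    ¬ _root_.ResolutionOfSingularities :=
  fun hs => h (affineToGlobal_of_summit hs)

/-- No field has a composite non-zero characteristic, so `ResolutionInChar p` is vacuous there.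
[folklore] -/
theorem resolutionInChar_of_not_prime {p : ℕ} (hp : ¬ p.Prime) (h0 : p ≠ 0) :
    ResolutionInChar.{0} p := by
  intro k _ _ X f _ _ _ _
  exfalso
  rcases CharP.char_is_prime_or_zero k p with h | h
  · exact hp h
  · exact h0 h

/-- … and so is `OneShot p d`. [folklore] -/
theorem oneShot_of_not_prime {p : ℕ} (hp : ¬ p.Prime) (h0 : p ≠ 0) (d : ℕ) : OneShot p d := by
  intro K _ _ A _ _ _ _ _
  exfalso
  rcases CharP.char_is_prime_or_zero K p with h | h
  · exact hp h
  · exact h0 h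

/-- The crux with the hypothesis `p.Prime` DROPPED. [folklore] -/
def AffineToGlobalWithoutPrime : Prop :=
  ∀ p : ℕ, (∀ d : ℕ, OneShot p d) → ResolutionInChar.{0} p

/-- **`p.Prime` is not load-bearing**: without it the statement is the crux plus its
characteristic-zero instance (affine one-shots in char 0 ⇒ Hironaka's theorem, true but not in
tree); composite `p` contribute nothing. [folklore] -/
theorem withoutPrime_iff :
    AffineToGlobalWithoutPrime ↔
      AffineToGlobal ∧ ((∀ d : ℕ, OneShot 0 d) → ResolutionInChar.{0} 0) := by
  constructor
  · exact fun h => ⟨fun p _ hO => h p hO, h 0⟩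
  · rintro ⟨hA, h0⟩ p hO
    by_cases hp : p.Prime
    · exact hA p hp hO
    · by_cases hz : p = 0
      · subst hz
        exact h0 hO
      · exact resolutionInChar_of_not_prime hp hz

/-! ## (b) Tightness and redundancy inside `OneShot` -/

/-- `OneShot p 0` is vacuous: an integral domain has `ringKrullDim ≥ 0`. [folklore] -/
theorem oneShot_zero (p : ℕ) : OneShot p 0 := by
  intro K _ _ A _ _ _ _ hdim
  exfalso
  have h0 : (0 : WithBot ℕ∞) ≤ ringKrullDim A := ringKrullDim_nonneg_of_nontrivial
  exact absurd hdim (not_lt.mpr (by simpa using h0))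

/-- The localisation of a domain at the zero ideal is a field, hence a regular local ring.
[folklore] -/
theorem isRegularLocalRing_localization_bot (A : Type*) [CommRing A] [IsDomain A] :
    IsRegularLocalRing (Localization.AtPrime (⊥ : Ideal A)) := by
  let _ : Field (Localization.AtPrime (⊥ : Ideal A)) := IsField.toField <| by
    simp [IsLocalRing.isField_iff_maximalIdeal_eq, ← Localization.AtPrime.map_eq_maximalIdeal]
  infer_instance

/-- **The conjunct `I ≠ ⊥` of `OneShot` is decoration**: it follows from the clause
`V(I) = Sing` alone, because the generic point of an integral affine scheme is regular.
[folklore] -/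
theorem centre_ne_bot_of_centre_iff {A : Type*} [CommRing A] [IsDomain A] {I : Ideal A}
    (h : ∀ 𝔭 : PrimeSpectrum A, I ≤ 𝔭.asIdeal ↔
      ¬ IsRegularLocalRing (Localization.AtPrime 𝔭.asIdeal)) : I ≠ ⊥ := by
  rintro rfl
  exact (h ⟨⊥, Ideal.isPrime_bot⟩).mp le_rfl (isRegularLocalRing_localization_bot A)

/-- **On a regular ring the clause `V(I) = Sing` forces the unit ideal**: the only admissible
one-shot centre of a regular integral affine variety is `I = ⊤`. [folklore] -/
theorem centre_eq_top_of_isRegularRing {A : Type*} [CommRing A] [IsRegularRing A] {I : Ideal A}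
    (h : ∀ 𝔭 : PrimeSpectrum A, I ≤ 𝔭.asIdeal ↔
      ¬ IsRegularLocalRing (Localization.AtPrime 𝔭.asIdeal)) : I = ⊤ := by
  by_contra hI
  obtain ⟨M, hM, hIM⟩ := Ideal.exists_le_maximal I hI
  exact (h ⟨M, hM.isPrime⟩).mp hIM inferInstance

/-- The one-element sequence `(1)` is quasi-regular (its ideal is the unit ideal, so the
coefficient condition is empty). [folklore] -/
theorem isQuasiRegular_one (A : Type*) [CommRing A] : IsQuasiRegular ![(1 : A)] := by
  intro n F _ _
  have htop : Ideal.span (Set.range ![(1 : A)]) = ⊤ :=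
    (Ideal.eq_top_iff_one _).mpr (Ideal.subset_span ⟨0, rfl⟩)
  rw [htop, Ideal.map_top]
  trivial

/-- **`Bl_⊤(Spec A) = Proj A[t]` is regular for a regular ring `A`** (the tree's Liu 8.1.19 (a)
in the affine quasi-regular form, at the sequence `(1)`: `A/(1) = 0` is a regular ring
vacuously). [cite: Liu2002, Thm. 8.1.19 (a)] -/
theorem isRegular_affineBlowup_top (A : Type*) [CommRing A] [IsRegularRing A] :
    Scheme.IsRegular (affineBlowup (⊤ : Ideal A)) := by
  have htop : Ideal.span (Set.range ![(1 : A)]) = ⊤ :=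
    (Ideal.eq_top_iff_one _).mpr (Ideal.subset_span ⟨0, rfl⟩)
  haveI : Subsingleton (A ⧸ Ideal.span (Set.range ![(1 : A)])) :=
    Ideal.Quotient.subsingleton_iff.mpr htop
  haveI : IsRegularRing (A ⧸ Ideal.span (Set.range ![(1 : A)])) :=
    { isRegularLocalRing_localization := fun p hp =>
        (hp.ne_top (Subsingleton.elim p ⊤)).elim }
  have h := affineBlowup.isRegular_of_isQuasiRegular ![(1 : A)] (isQuasiRegular_one A)
  rwa [htop] at h

/-- **The hypothesis is satisfiable on every regular integral affine variety, by `I = ⊤`** (and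
only by it, `centre_eq_top_of_isRegularRing`). [folklore] -/
theorem oneShot_witness_of_isRegularRing (A : Type*) [CommRing A] [IsDomain A] [IsRegularRing A] :
    ∃ I : Ideal A, I ≠ ⊥ ∧ Scheme.IsRegular (affineBlowup I) ∧
      ∀ 𝔭 : PrimeSpectrum A, I ≤ 𝔭.asIdeal ↔
        ¬ IsRegularLocalRing (Localization.AtPrime 𝔭.asIdeal) := by
  refine ⟨⊤, ?_, isRegular_affineBlowup_top A, fun 𝔭 => ?_⟩
  · exact top_ne_bot
  · constructor
    · intro h
      exact (𝔭.isPrime.ne_top (top_le_iff.mp h)).elim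
    · intro h
      exact (h inferInstance).elim

/-- **`OneShot p 1` holds** (base of the hypothesis family is not junk-false): an integral
finite-type algebra of Krull dimension `< 1` over a field is a field, hence regular, and `I = ⊤`
is a one-shot centre. [folklore] -/
theorem oneShot_one (p : ℕ) : OneShot p 1 := by
  intro K _ _ A _ _ _ _ hdim
  -- `dim A ≤ 0`
  have hle : ringKrullDim A ≤ 0 := by
    cases h : ringKrullDim A using WithBot.recBotCoe with
    | bot => exact bot_le
    | coe n =>
      rw [h] at hdim
      have hn : n = 0 := by simpa using hdim
      simp [hn]
  haveI : Ring.KrullDimLE 0 A := (Ring.krullDimLE_iff (n := 0) (R := A)).mpr hle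
  have hF : IsField A := Ring.KrullDimLE.isField_of_isDomain
  letI : Field A := hF.toField
  exact oneShot_witness_of_isRegularRing A

/-! ## (d) Line `birth` — no stuck stubs were handed over; see the module docstring for the
stub-by-stub findings (`stub_idealExtension`, `stub_localModel` true — could not break;
`stub_affineToModification` open, crux-equivalent in kind). Nothing kernel-level to add beyond
the tree's own `isIso_stalkMap_of_flat_of_isPreimmersion` (non-Noetherian corner of
`stub_localModel`) and the lead's `ModificationOneShot.affine_case`. -/

/-! ## (c') [gen 2] The hypothesis never determines its centre — `∃!` refuted
(landed: `Theorems/AffineToGlobal/Negative/CentreNotUnique.lean`, p162244; re-exported here so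
that ideators / planners reading this file have the statements in one place) -/

/-- **At a singular integral Noetherian affine scheme the one-shot centre is never unique**: a
one-shot centre `I` (`I ≠ ⊥`, `Bl_I` regular, `V(I) = Sing`) has the companion `I·I ≠ I`.
[cite: StacksProject, Tag 080A] -/
theorem oneShotCentre_not_unique {R : Type} [CommRing R] [IsDomain R] [IsNoetherianRing R]
    {I : Ideal R}
    (h : I ≠ ⊥ ∧ Scheme.IsRegular (affineBlowup I) ∧
      ∀ 𝔭 : PrimeSpectrum R, I ≤ 𝔭.asIdeal ↔
        ¬ IsRegularLocalRing (Localization.AtPrime 𝔭.asIdeal))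
    (hsing : ∃ 𝔭 : PrimeSpectrum R, ¬ IsRegularLocalRing (Localization.AtPrime 𝔭.asIdeal)) :
    ∃ J : Ideal R, J ≠ I ∧ J ≠ ⊥ ∧ Scheme.IsRegular (affineBlowup J) ∧
      ∀ 𝔭 : PrimeSpectrum R, J ≤ 𝔭.asIdeal ↔
        ¬ IsRegularLocalRing (Localization.AtPrime 𝔭.asIdeal) :=
  Theorems.AffineToGlobal.Negative.exists_ne_oneShotCentre h hsing

/-- **Refuted natural strengthening of the hypothesis: `∃! I` in `OneShot p 2` fails for every
prime `p`** (witness: the cusp `(ZMod p)[X², X³]`, whose conductor and its square are two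
distinct one-shot centres). [folklore] -/
theorem not_oneShot_two_existsUnique (p : ℕ) (hp : p.Prime) :
    ¬ ∀ (K : Type) [Field K] [CharP K p] (A : Type) [CommRing A] [IsDomain A] [Algebra K A]
        [Algebra.FiniteType K A], ringKrullDim A < ((2 : ℕ) : WithBot ℕ∞) →
        ∃! I : Ideal A, I ≠ ⊥ ∧ Scheme.IsRegular (affineBlowup I) ∧
          ∀ 𝔭 : PrimeSpectrum A, I ≤ 𝔭.asIdeal ↔
            ¬ IsRegularLocalRing (Localization.AtPrime 𝔭.asIdeal) :=
  Theorems.AffineToGlobal.Negative.not_oneShot_two_existsUnique p hp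

/-- **Under the crux's hypothesis at `p`, EVERY singular integral affine variety of finite type
over a field of characteristic `p` has two distinct one-shot centres** — what a gluing argument
for `AffineToGlobal` is up against on every chart. [folklore] -/
theorem two_centres_of_hypothesis (p : ℕ) (h : ∀ d : ℕ, OneShot p d)
    (K : Type) [Field K] [CharP K p] (A : Type) [CommRing A] [IsDomain A] [Algebra K A]
    [Algebra.FiniteType K A]
    (hsing : ∃ 𝔭 : PrimeSpectrum A, ¬ IsRegularLocalRing (Localization.AtPrime 𝔭.asIdeal)) :
    ∃ I J : Ideal A, I ≠ J ∧
      (I ≠ ⊥ ∧ Scheme.IsRegular (affineBlowup I) ∧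
        ∀ 𝔭 : PrimeSpectrum A, I ≤ 𝔭.asIdeal ↔
          ¬ IsRegularLocalRing (Localization.AtPrime 𝔭.asIdeal)) ∧
      (J ≠ ⊥ ∧ Scheme.IsRegular (affineBlowup J) ∧
        ∀ 𝔭 : PrimeSpectrum A, J ≤ 𝔭.asIdeal ↔
          ¬ IsRegularLocalRing (Localization.AtPrime 𝔭.asIdeal)) :=
  Theorems.AffineToGlobal.Negative.exists_two_oneShotCentres_of_hypothesis p
    (fun d K _ _ A _ _ _ _ hd => h d K A hd) K A hsing

/-! ## (e) [gen 2] The canonical candidate fails: the reduced singular locus is not a one-shot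
centre (landed: `Theorems/AffineToGlobal/Negative/{BlowupChartEmbedding,PointBlowupNotRegular,
ReducedSingularLocusCentre}.lean`, p163762 / p164202 / p164577; re-exported) -/

/-- **`y² = x⁵`: for every field `K`, the curve `K[X², X⁵]` has a singular closed point whose
blowing up (reduced centre) is not regular.** [cite: Kollar2007, §1.4] -/
theorem exists_point_blowup_not_regular (K : Type) [Field K] :
    ∃ 𝔭 : PrimeSpectrum ↥(Algebra.adjoin K ({Polynomial.X ^ 2, Polynomial.X ^ 5} :
        Set (Polynomial K))),
      𝔭.asIdeal.IsMaximal ∧ ¬ IsRegularLocalRing (Localization.AtPrime 𝔭.asIdeal) ∧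
      ¬ Scheme.IsRegular (affineBlowup 𝔭.asIdeal) :=
  Theorems.AffineToGlobal.Negative.exists_point_blowup_not_regular K

/-- **Refuted strengthening, every prime `p`: "blowing up an affine curve at a singular closed
point (reduced centre) gives a regular scheme".** [folklore] -/
theorem not_reducedPoint_oneShotCentre (p : ℕ) (hp : p.Prime) :
    ¬ ∀ (K : Type) [Field K] [CharP K p] (A : Type) [CommRing A] [IsDomain A] [Algebra K A]
        [Algebra.FiniteType K A], ringKrullDim A < ((2 : ℕ) : WithBot ℕ∞) →
        ∀ 𝔭 : PrimeSpectrum A, 𝔭.asIdeal.IsMaximal →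
          ¬ IsRegularLocalRing (Localization.AtPrime 𝔭.asIdeal) →
          Scheme.IsRegular (affineBlowup 𝔭.asIdeal) :=
  Theorems.AffineToGlobal.Negative.not_reducedPoint_oneShotCentre p hp

/-- **Refuted strengthening, every prime `p`: "the reduced singular locus of an affine curve is a
one-shot centre"** (blowing up the vanishing ideal of the non-regular locus gives a regular
scheme). The canonical, globally gluing candidate is thus unavailable to any gluing proof of
`AffineToGlobal`. [folklore] -/
theorem not_reducedSingularLocus_oneShotCentre (p : ℕ) (hp : p.Prime) :
    ¬ ∀ (K : Type) [Field K] [CharP K p] (A : Type) [CommRing A] [IsDomain A] [Algebra K A]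
        [Algebra.FiniteType K A], ringKrullDim A < ((2 : ℕ) : WithBot ℕ∞) →
        Scheme.IsRegular (affineBlowup
          (⨅ 𝔮 ∈ {𝔮 : PrimeSpectrum A | ¬ IsRegularLocalRing (Localization.AtPrime 𝔮.asIdeal)},
            𝔮.asIdeal)) :=
  Theorems.AffineToGlobal.Negative.not_reducedSingularLocus_oneShotCentre p hp

/-! ## (d2) [gen 2] Line `birth`, reshape 3 — the two open residues

`stub_isolatingBlowup` (weak frame) and `stub_infiniteSingularLocus` (Temkin frame); see the
module docstring. The guards of the former are landed
(`Theorems/AffineToGlobal/Negative/WeakFrameStubs.lean`, p162423) and re-exported; for the latter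
two one-liners record that its degenerate instances are excluded by its own hypothesis `hinf`. -/

/-- `stub_isolatingBlowup` without `J₁ ≠ ⊥` is vacuous on every scheme (blow-up along `⊥`).
[cite: Temkin2008, Def. 2.2.6] -/
theorem isolatingBlowup_vacuous_without_ne_bot (X : Scheme.{0}) :
    ∃ (X₁ : Scheme.{0}) (π₁ : X₁ ⟶ X) (J₁ : X.IdealSheafData),
      IsBlowup π₁ J₁ ∧ (Scheme.regularLocus X₁)ᶜ.Finite :=
  Theorems.AffineToGlobal.Negative.exists_isBlowup_finite_compl_regularLocus X

/-- `stub_isolatingBlowup` without `IsIntegral X` is false (the empty closed subscheme of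
`ℙⁿ_K`). [folklore] -/
theorem isolatingBlowup_false_without_isIntegral (K : Type) [Field K] (n : ℕ) :
    ¬ ∀ (X : Scheme.{0})
        (ι : X ⟶ (Literature.AlgebraicGeometry.Motives.projectiveSpace n K).left),
        IsClosedImmersion ι →
        ∃ (X₁ : Scheme.{0}) (π₁ : X₁ ⟶ X) (J₁ : X.IdealSheafData),
          J₁ ≠ ⊥ ∧ IsBlowup π₁ J₁ ∧ (Scheme.regularLocus X₁)ᶜ.Finite :=
  Theorems.AffineToGlobal.Negative.isolatingBlowupShape_false_without_isIntegral K n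

/-- `stub_isolatingBlowup` is free where the non-regular locus is already finite (identity,
`J₁ = ⊤`). [cite: GortzWedhorn2020, (13.19)] -/
theorem isolatingBlowup_of_finite (X : Scheme.{0}) [Nonempty X]
    (hfin : (Scheme.regularLocus X)ᶜ.Finite) :
    ∃ (X₁ : Scheme.{0}) (π₁ : X₁ ⟶ X) (J₁ : X.IdealSheafData),
      J₁ ≠ ⊥ ∧ IsBlowup π₁ J₁ ∧ (Scheme.regularLocus X₁)ᶜ.Finite :=
  Theorems.AffineToGlobal.Negative.isolatingBlowupShape_of_finite X hfin

/-- In `stub_infiniteSingularLocus` the hypothesis `hinf` forces the centre `I ≠ ⊥`: a blow-up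
along `⊥` is empty, with (empty, hence finite) non-regular locus. [cite: Temkin2008, Def. 2.2.6] -/
theorem centre_ne_bot_of_infinite {S' S : Scheme.{0}} {g : S' ⟶ S} {I : S.IdealSheafData}
    (hg : IsBlowup g I) (hinf : (Scheme.regularLocus S')ᶜ.Infinite) : I ≠ ⊥ := by
  rintro rfl
  haveI := hg.isEmpty_of_bot
  exact hinf (Set.toFinite _)

/-- … and forces `S'` to be singular, so the conclusion `AdmitsDesingularization S'` is not
available from `Scheme.IsRegular.admitsDesingularization`. [folklore] -/
theorem not_isRegular_of_infinite {S' : Scheme.{0}} (hinf : (Scheme.regularLocus S')ᶜ.Infinite) :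
    ¬ Scheme.IsRegular S' := by
  intro h
  apply hinf
  have : (Scheme.regularLocus S')ᶜ = ∅ :=
    Set.compl_empty_iff.mpr (Set.eq_univ_of_forall fun x => h x)
  rw [this]
  exact Set.finite_empty

end Summit.ResolutionOfSingularities.ResolutionOfSingularities.Cruxes.AffineToGlobal.Disproof

end
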